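import Summits.QuantumFields.YangMills.Theorems.FemtoCutoffLadderAssemblyTelescoping
import Summits.QuantumFields.YangMills.Theorems.LuscherReductionRunningReductionBOHandoverLabels

/-!
# Femto transfer gap — THE CUTOFF LADDER with a TELESCOPING matching allowance (repair R1 of crux `UniformStepScaling`)

Lead seat `ym-line-fcl-p1` (2026-08-28), route `FemtoCutoffLadder` (rung R2b1 leaf `FemtoGapOfRecord`).  The one-sided uniform octave step
as typed (crux stmt-QuantumFields-23836: slack `e^{CΛ²/L'^σ}` at matched TWO-LOOP label) cannot hold: three-loop asymptotic scaling
(`aΛ_L = two-loop × (1 + q g₀² + …)`, `q = +0.08324` for `SU(2)` [cite: AllesFeoPanagopoulos1997, eq. (3.7)]) makes the finer lattice of a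
label-matched pair physically smaller by `2q(1/β − 1/β')`, an `L'`-INDEPENDENT deficit in `z` that no power-decaying slack absorbs (evidence
`Cruxes/UniformStepScaling/Misstated.md`).  The deficit TELESCOPES along the halving chain, so the natural repair is an extra allowance
`e^{D(1/β' − 1/β)}` per step (R1).  This module proves that the dyadic telescoping survives R1 verbatim:

★ `femtoGapOfRecord_of_ladderR1` — (hS') one-sided octave step with slack `exp(CΛ²/L'^σ + D(1/β' − 1/β))`, `D ≥ 0`, + (hP) coarse pairs
`(L,1)` + (hA) one-site anchor + (hM) deep-window matching ⟹ `FemtoGapOfRecord`, output constant `C_tot + D/2`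
(the allowances sum to `D(1/β_coarsest − 1/β) ≤ D/β_coarsest ≤ (D/2)Λ³ ≤ (D/2)Λ²` on the window: `1/β ≤ Λ³/2`, `inv_le_half_luscherLambda_cube`).

Same induction as `femtoGapOfRecord_of_ladder` (potential `L^{−σ}`), with the invariant carrying the extra budget `D(Λ³/2 − 1/β) ≥ 0`.

HONEST FRAMING: bookkeeping only (real analysis over the tree's positivity lemmas); it proves neither the repaired step nor the fixed-lattice
leaf; R2b1 is a RECORD rung — nothing here is infinite volume, a mass gap or the Clay problem.  No definitions, no named facts, no `sorry`.
-/

set_option autoImplicit false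

noncomputable section

namespace Summit.QuantumFields.YangMills.Theorems.FemtoTransferGap.CutoffLadder

open Real
open Summit.QuantumFields.YangMills.Theorems.FemtoTransferGap
open Literature.Analysis.OperatorTheory.YMMatrixModel (luscherEps1)

/-- On the femto window (`β ≥ 1`, `0 < lam ≤ Λ(β,L)`): `1/β ≤ Λ(β,L)³/2` — since `Λ⁻³ = 1/ḡ² ≤ β/2`. [cite: LuscherMunster1984, §2] -/
theorem inv_le_half_luscherLambda_cube {lam β : ℝ} {L : ℕ} [NeZero L] (hlam : 0 < lam) (hW : InFemtoWindow lam β L) :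
    1 / β ≤ luscherLambda β L ^ 3 / 2 := by
  have hβ1 : 1 ≤ β := hW.1
  have hβ0 : 0 < β := by linarith
  have hl : 0 < luscherLambda β L := lt_of_lt_of_le hlam hW.2.1
  have hv : 0 < invRunningCoupling β L := BOHandover.invRunningCoupling_pos_of_luscherLambda_pos hl
  rw [BOHandover.luscherLambda_pow_three hv]
  have hle : invRunningCoupling β L ≤ β / 2 := BOHandover.invRunningCoupling_le_half hβ1 L
  have h := (inv_le_inv₀ (by positivity : (0 : ℝ) < β / 2) hv).mpr hle
  have h2 : (β / 2)⁻¹ = 2 / β := by rw [inv_div]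
  rw [h2] at h
  have h1 : 1 / β = (2 / β) / 2 := by field_simp
  rw [h1]
  exact div_le_div_of_nonneg_right h (by norm_num)
set_option maxHeartbeats 400000 in
/-- ★ **THE CUTOFF LADDER WITH THE TELESCOPING ALLOWANCE (repair R1).**  From (hS') the one-sided uniform octave step above an absolute `L₀`
with slack `exp(CΛ²/L'^σ + D(1/β' − 1/β))`, `D ≥ 0` (the second term absorbs the `L'`-independent three-loop size mismatch of label-matched
pairs and telescopes along the halving chain), (hP) the one-sided coarse pairs `(L, 1)`, (hA) the one-site anchor and (hM) deep-window
matching, the rung leaf `FemtoGapOfRecord` follows with `C = |C_a| + Σ_{L<2L₀+2}|C_L| + max(C,0)/(1 − (3/4)^σ) + D/2`, `L₀(lam) = 0`.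
[cite: LuscherWeiszWolff1991] [cite: AllesFeoPanagopoulos1997, eq. (3.7)] -/
theorem femtoGapOfRecord_of_ladderR1
    (hS : ∃ (C σ D lam0 : ℝ) (L0 : ℕ), 0 < σ ∧ 0 < lam0 ∧ 0 ≤ D ∧ ∀ lam : ℝ, 0 < lam → lam ≤ lam0 →
      ∀ (L' : ℕ) [NeZero L'] (L : ℕ) [NeZero L], L0 ≤ L' → L' ≤ L → L ≤ 2 * L' →
        ∀ β β' : ℝ, InFemtoWindow lam β L → InFemtoWindow lam β' L' → luscherLambda β L = luscherLambda β' L' →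
          secondValue su2Rep L β ^ L * topValue su2Rep L' β' ^ L' ≤
            Real.exp (C * luscherLambda β L ^ 2 / (L' : ℝ) ^ σ + D * (1 / β' - 1 / β)) *
              (secondValue su2Rep L' β' ^ L' * topValue su2Rep L β ^ L))
    (hP : ∀ (L : ℕ) [NeZero L], ∃ C lam0 : ℝ, 0 < lam0 ∧ ∀ lam : ℝ, 0 < lam → lam ≤ lam0 →
      ∀ β β' : ℝ, InFemtoWindow lam β L → InFemtoWindow lam β' 1 → luscherLambda β L = luscherLambda β' 1 →
        secondValue su2Rep L β ^ L * topValue su2Rep 1 β' ^ 1 ≤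
          Real.exp (C * luscherLambda β L ^ 2) * (secondValue su2Rep 1 β' ^ 1 * topValue su2Rep L β ^ L))
    (hA : ∃ C lam0 : ℝ, 0 < lam0 ∧ ∀ lam : ℝ, 0 < lam → lam ≤ lam0 → ∀ β : ℝ, InFemtoWindow lam β 1 →
      secondValue su2Rep 1 β ≤ Real.exp (-(zLower C β 1)) * topValue su2Rep 1 β)
    (hM : ∀ lam : ℝ, 0 < lam → lam ≤ 1 / 2 → ∀ (L : ℕ) [NeZero L] (L' : ℕ) [NeZero L'] (β : ℝ),
      InFemtoWindow lam β L → ∃ β' : ℝ, InFemtoWindow lam β' L' ∧ luscherLambda β' L' = luscherLambda β L) :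
    FemtoGapOfRecord := by
  obtain ⟨Cs, σ, D, lamS, L0s, hσ, hlamS, hD, HS⟩ := hS
  obtain ⟨Ca, lamA, hlamA, HA⟩ := hA
  choose Cp lamP hlamP HP using fun n : ℕ => hP (n + 1)
  -- the threshold below which coarse pairs are used, and the merged constants
  set N : ℕ := 2 * L0s + 2 with hN
  have hNpos : 0 < N := by omega
  have hne : (Finset.range N).Nonempty := ⟨0, Finset.mem_range.mpr hNpos⟩
  set Csp : ℝ := max Cs 0 with hCsp
  have hCsp0 : 0 ≤ Csp := le_max_right _ _
  have hCsle : Cs ≤ Csp := le_max_left _ _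
  set q : ℝ := (3 / 4 : ℝ) ^ σ with hq_def
  have hq1 : q < 1 := Real.rpow_lt_one (by norm_num) (by norm_num) hσ
  set κ : ℝ := 1 - q with hκ_def
  have hκ : 0 < κ := by rw [hκ_def]; linarith
  have hqκ : q = 1 - κ := by rw [hκ_def]; ring
  set M : ℝ := ∑ n ∈ Finset.range N, |Cp n| with hM_def
  set Ctot : ℝ := |Ca| + M + Csp / κ with hCtot
  set lamPmin : ℝ := (Finset.range N).inf' hne lamP with hlamPmin_def
  have hlamPmin : 0 < lamPmin := (Finset.lt_inf'_iff hne).mpr fun n _ => hlamP n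
  -- the potential and the running constant of the induction
  let w : ℕ → ℝ := fun m => (((m : ℕ) : ℝ) ^ σ)⁻¹
  let F : ℕ → ℝ := fun m => |Ca| + M + Csp / κ * (1 - w m)
  have hw0 : ∀ m : ℕ, 0 ≤ w m := fun m => inv_nonneg.mpr (Real.rpow_nonneg (Nat.cast_nonneg m) σ)
  have hw1 : ∀ m : ℕ, 0 < m → w m ≤ 1 := fun m hm => by
    haveI : NeZero m := ⟨Nat.pos_iff_ne_zero.mp hm⟩
    exact potential_le_one hσ.le m
  have hFle : ∀ m : ℕ, F m ≤ Ctot := fun m => by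
    have : Csp / κ * (1 - w m) ≤ Csp / κ := by
      have h := hw0 m
      have hck : 0 ≤ Csp / κ := div_nonneg hCsp0 hκ.le
      nlinarith
    show |Ca| + M + Csp / κ * (1 - w m) ≤ |Ca| + M + Csp / κ
    linarith
  have hFge : ∀ m : ℕ, 0 < m → |Ca| + M ≤ F m := fun m hm => by
    have : 0 ≤ Csp / κ * (1 - w m) := mul_nonneg (div_nonneg hCsp0 hκ.le) (by linarith [hw1 m hm])
    show |Ca| + M ≤ |Ca| + M + Csp / κ * (1 - w m)
    linarith
  refine ⟨Ctot + D / 2, min (min lamS lamA) (min lamPmin (1 / 2)),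
    lt_min (lt_min hlamS hlamA) (lt_min hlamPmin (by norm_num)), ?_⟩
  intro lam hlam hle
  have hleS : lam ≤ lamS := hle.trans ((min_le_left _ _).trans (min_le_left _ _))
  have hleA : lam ≤ lamA := hle.trans ((min_le_left _ _).trans (min_le_right _ _))
  have hleP : lam ≤ lamPmin := hle.trans ((min_le_right _ _).trans (min_le_left _ _))
  have hhalf : lam ≤ 1 / 2 := hle.trans ((min_le_right _ _).trans (min_le_right _ _))
  -- ### the induction: for every `n`, every window point on the lattice `n + 1`; the invariant carries the budget `D(Λ³/2 − 1/β) ≥ 0`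
  have claim : ∀ n : ℕ, ∀ β : ℝ, InFemtoWindow lam β (n + 1) →
      secondValue su2Rep (n + 1) β ^ (n + 1) ≤
        Real.exp (-(luscherEps1 * luscherLambda β (n + 1)) + F (n + 1) * luscherLambda β (n + 1) ^ 2 +
            D * (luscherLambda β (n + 1) ^ 3 / 2 - 1 / β)) *
          topValue su2Rep (n + 1) β ^ (n + 1) := by
    intro n
    induction n using Nat.strong_induction_on with
    | _ n ih =>
      intro β hW
      set Λ : ℝ := luscherLambda β (n + 1) with hΛ
      have hb : 0 ≤ topValue su2Rep (n + 1) β ^ (n + 1) := pow_nonneg (topValue_su2Rep_pos (n + 1) β).le _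
      have hbud : 0 ≤ D * (Λ ^ 3 / 2 - 1 / β) :=
        mul_nonneg hD (by linarith [inv_le_half_luscherLambda_cube hlam hW])
      by_cases hn : n + 1 < N
      · -- BASE: coarse pair `(n+1, 1)` and the anchor
        have hnr : n ∈ Finset.range N := Finset.mem_range.mpr (by omega)
        have hleP' : lam ≤ lamP n := hleP.trans (Finset.inf'_le lamP hnr)
        obtain ⟨β', hW', hmatch⟩ := hM lam hlam hhalf (n + 1) 1 β hW
        have h1 := HP n lam hlam hleP' β β' hW hW' hmatch.symm
        simp only [pow_one] at h1
        have h2 := HA lam hlam hleA β' hW'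
        have hb' : 0 < topValue su2Rep 1 β' := topValue_su2Rep_pos 1 β'
        have h3 := le_of_pair_of_partner hb' hb h1 h2
        refine h3.trans (exp_mul_le_exp_mul ?_ hb)
        have hz : zLower Ca β' 1 = luscherEps1 * Λ - Ca * Λ ^ 2 := by
          show luscherEps1 * luscherLambda β' 1 - Ca * luscherLambda β' 1 ^ 2 = _
          rw [hmatch]
        rw [hz]
        have hCpM : Cp n ≤ M := (le_abs_self _).trans (Finset.single_le_sum (fun m _ => abs_nonneg (Cp m)) hnr)
        have hCa : Ca ≤ |Ca| := le_abs_self _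
        have hF := hFge (n + 1) (Nat.succ_pos n)
        nlinarith [sq_nonneg Λ]
      · -- STEP: octave `(n'+1, n+1)`, `n' = n / 2`; the partner's `−D/β'` cancels the step's `+D/β'`
        push Not at hn
        set n' : ℕ := n / 2 with hn'
        have hlt : n' < n := by omega
        have hL0 : L0s ≤ n' + 1 := by omega
        have hle1 : n' + 1 ≤ n + 1 := by omega
        have hle2 : n + 1 ≤ 2 * (n' + 1) := by omega
        have h43 : 4 * (n' + 1) ≤ 3 * (n + 1) := by omega
        obtain ⟨β', hW', hmatch⟩ := hM lam hlam hhalf (n + 1) (n' + 1) β hW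
        have h1 := HS lam hlam hleS (n' + 1) (n + 1) hL0 hle1 hle2 β β' hW hW' hmatch.symm
        have h2 := ih n' hlt β' hW'
        have hb' : 0 < topValue su2Rep (n' + 1) β' ^ (n' + 1) := pow_pos (topValue_su2Rep_pos (n' + 1) β') _
        have h3 := le_of_pair_of_partner hb' hb h1 h2
        refine h3.trans (exp_mul_le_exp_mul ?_ hb)
        rw [hmatch]
        -- the slack `Cs Λ²/L'^σ = (Cs · w L') Λ²` and the budget
        have hslack : Cs * Λ ^ 2 / (((n' + 1 : ℕ) : ℝ)) ^ σ = Cs * w (n' + 1) * Λ ^ 2 := by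
          show Cs * Λ ^ 2 / (((n' + 1 : ℕ) : ℝ)) ^ σ = Cs * ((((n' + 1 : ℕ) : ℝ)) ^ σ)⁻¹ * Λ ^ 2
          ring
        rw [hslack]
        have hcontr : w (n + 1) ≤ q * w (n' + 1) :=
          potential_contract hσ.le (Nat.succ_pos n') h43
        have hbudget := step_budget hCsle hCsp0 hκ hqκ (hw0 (n' + 1)) hcontr
        have hFn : F (n + 1) = |Ca| + M + Csp / κ * (1 - w (n + 1)) := rfl
        have hFn' : F (n' + 1) = |Ca| + M + Csp / κ * (1 - w (n' + 1)) := rfl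
        rw [hFn, hFn']
        nlinarith [sq_nonneg Λ]
  -- ### conclusion: `L`-th roots, `L₀(lam) = 0`; the budget is `≤ (D/2)Λ³ ≤ (D/2)Λ²` since `Λ ≤ 2·lam ≤ 1`
  refine ⟨0, ?_⟩
  intro L _ _ β hW
  obtain ⟨n, rfl⟩ : ∃ n, L = n + 1 := Nat.exists_eq_succ_of_ne_zero (NeZero.ne L)
  have h := claim n β hW
  have hb : 0 ≤ topValue su2Rep (n + 1) β ^ (n + 1) := pow_nonneg (topValue_su2Rep_pos (n + 1) β).le _
  have hΛ0 : 0 ≤ luscherLambda β (n + 1) := hlam.le.trans hW.2.1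
  have hΛ1 : luscherLambda β (n + 1) ≤ 1 := hW.2.2.trans (by linarith)
  have hβ0 : 0 < β := by linarith [hW.1]
  have hDβ : 0 ≤ D * (1 / β) := mul_nonneg hD (by positivity)
  have hcube : luscherLambda β (n + 1) ^ 3 ≤ luscherLambda β (n + 1) ^ 2 := by
    have := mul_le_mul_of_nonneg_left hΛ1 (sq_nonneg (luscherLambda β (n + 1)))
    nlinarith
  have h' : secondValue su2Rep (n + 1) β ^ (n + 1) ≤
      Real.exp (-(zLower (Ctot + D / 2) β (n + 1))) * topValue su2Rep (n + 1) β ^ (n + 1) := by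
    refine h.trans (exp_mul_le_exp_mul ?_ hb)
    show -(luscherEps1 * luscherLambda β (n + 1)) + F (n + 1) * luscherLambda β (n + 1) ^ 2 +
        D * (luscherLambda β (n + 1) ^ 3 / 2 - 1 / β) ≤
      -(luscherEps1 * luscherLambda β (n + 1) - (Ctot + D / 2) * luscherLambda β (n + 1) ^ 2)
    have hDc : D * (luscherLambda β (n + 1) ^ 3 / 2) ≤ D / 2 * luscherLambda β (n + 1) ^ 2 := by
      have := mul_le_mul_of_nonneg_left hcube hD
      linarith
    have hFl : F (n + 1) * luscherLambda β (n + 1) ^ 2 ≤ Ctot * luscherLambda β (n + 1) ^ 2 :=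
      mul_le_mul_of_nonneg_right (hFle (n + 1)) (sq_nonneg _)
    have hsplit : D * (luscherLambda β (n + 1) ^ 3 / 2 - 1 / β) =
        D * (luscherLambda β (n + 1) ^ 3 / 2) - D * (1 / β) := by ring
    rw [hsplit]
    linarith
  exact root_of_pow_le (secondValue_su2Rep_pos (by linarith [hW.1])).le (topValue_su2Rep_pos (n + 1) β).le h'

end Summit.QuantumFields.YangMills.Theorems.FemtoTransferGap.CutoffLadder

end
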